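import Mathlib.Analysis.Complex.PhragmenLindelof
import Mathlib.NumberTheory.LSeries.RiemannZeta
import Mathlib.NumberTheory.ZetaValues
import Literature.NumberTheory.LFunctions.XiPrimitive
import Literature.NumberTheory.LFunctions.ZetaFractionalPartIntegral
import Literature.Analysis.SpecialFunctions.GammaStirlingOrder
import HarnessLib

/-!
# Lagarias–Montague 2011, Lemma 3.3 (1): the decay of `ξ` in the strip `½ ≤ Re s ≤ 2` — PROVED

Sibling proofs file (D-0014 append protocol) of `Literature/NumberTheory/LFunctions/XiPrimitive.lean`,
discharging its named fact `Literature.NumberTheory.LFunctions.LagariasMontague2011_lemma33_1`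
[LagariasMontague2011, Lemma 3.3 (1), p. 151]: there is `C₁ > 0` with

  `|ξ(s)| ≤ C₁ e^{−π|t|/4} (|t| + 1)^{5/2}`   for `½ ≤ Re s ≤ 2`, `t = Im s`.

## The printed proof and the proof given here

Lagarias–Montague (proof of Lemma 3.3 (1), p. 151 of the journal version = arXiv:1106.4348 p. 9)
multiply `|½ s(s−1)| = O(|t|²)`, `|π^{−s/2}| = O(1)`, `|Γ(s/2)| = O(e^{−π|t|/4})` and the convexity
bound `|ζ(s)| ≤ C|t|^{1/2}` (`σ ≥ ½`, `|t| ≥ 2`). The bookkeeping there is loose (on `Re s = 2`,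
`|Γ(1 + it/2)| ≍ |t|^{1/2} e^{−π|t|/4}`, and it is `|ζ(2 + it)| = O(1)` that restores the exponent
`5/2`), so instead of tracking `|Γ(s/2)| |ζ(s)|` across `½ ≤ σ ≤ 2` we prove the (true) statement by
the standard Phragmén–Lindelöf convexity argument (Titchmarsh, *Theory of Functions*, §5.65), with
exactly the same four ingredients:

* on the line `Re s = 2`: `ξ(s) = ½ s(s−1) π^{−s/2} Γ(s/2) ζ(s)` with `|ζ(2+it)| ≤ ζ(2) = π²/6 ≤ 2`
  (Dirichlet series) and the tree's Stirling-order bound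
  `|Γ(1 + iy)| ≤ 16π² (1+|y|)^{1/2} e^{−π|y|/2}` (`Literature.Analysis.SpecialFunctions.norm_Gamma_le_exp`,
  `|y| ≥ 1`; `|Γ(1+iy)| ≤ Γ(1) = 1` for `|y| < 1`), giving `|ξ(2+it)|² ≤ K e^{−π|t|/2}(1+|t|)⁵`;
* on the line `Re s = −1`: the same bound, by the functional equation `ξ(−1+it) = ξ(2−it)`;
* inside `−1 ≤ Re s ≤ 2`: polynomial growth `|ξ(s)| ≤ 80π²(1+|t|)⁴` (`|t| ≥ 2`), from the product
  formula, Titchmarsh's (2.12.2) `|ζ(s)| ≤ |s|/|s−1| + |s|/σ`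
  (`Literature.NumberTheory.LFunctions.norm_riemannZeta_le_of_re_pos`) and `ξ(1−s) = ξ(s)`;
* the Phragmén–Lindelöf principle (Mathlib `PhragmenLindelof.vertical_strip`, strip of width `3`)
  applied to `g(s) = ξ(s)² e^{−iπs/2} (s+10)^{−5}` (`|e^{−iπs/2}| = e^{πt/2}`; squares avoid
  half-integer powers), which is bounded on both edges; hence `|ξ(s)|² e^{πt/2} ≤ C|s+10|⁵` on the
  closed strip, i.e. the claim for `t ≥ 0`, and `ξ(s̄) = conj ξ(s)` gives `t ≤ 0`.

Everything here is proved; there are no new definitions and no named facts.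

## References

* J. C. Lagarias, D. Montague, *The integral of the Riemann ξ-function*, Comment. Math. Univ. St.
  Pauli 60 (2011), 143–169; arXiv:1106.4348 — Lemma 3.3 (1) and its proof. [LagariasMontague2011]
* E. C. Titchmarsh, *The Theory of the Riemann Zeta-Function*, 2nd ed. (1986), §2.12 eq. (2.12.2),
  §4.12 eq. (4.12.2); *The Theory of Functions*, 2nd ed., §5.65 (Phragmén–Lindelöf in a strip).
-/

noncomputable section

open Complex Filter Topology Set Asymptotics
open scoped Real ComplexConjugate

namespace Literature.NumberTheory.LFunctions

/-! ## The product formula and the factors on `Re s > 0` -/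

/-- `ξ(s) = ½ s(s−1) · π^{−s/2} Γ(s/2) · ζ(s)` for `Re s > 0`, `s ≠ 1` (Titchmarsh (2.1.12); all
factors are genuine there: `Γ_ℝ(s) = π^{−s/2}Γ(s/2) ≠ 0`). [cite: Titchmarsh1986, §2.1 eq. (2.1.12)] -/
theorem riemannXi_eq_Gamma_mul_zeta {s : ℂ} (hs : 0 < s.re) (hs1 : s ≠ 1) :
    riemannXi s =
      s * (s - 1) / 2 * ((π : ℂ) ^ (-s / 2) * Complex.Gamma (s / 2)) * riemannZeta s := by
  have hs0 : s ≠ 0 := fun h ↦ by rw [h, zero_re] at hs; exact lt_irrefl _ hs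
  have hG : Gammaℝ s ≠ 0 := Gammaℝ_ne_zero_of_re_pos hs
  have hΛ : completedRiemannZeta s = riemannZeta s * Gammaℝ s := by
    rw [riemannZeta_def_of_ne_zero hs0, div_mul_cancel₀ _ hG]
  rw [riemannXi_eq_mul_completedRiemannZeta hs0 hs1, hΛ, Gammaℝ_def]
  ring

/-- `‖π^{−w/2}‖ = π^{−Re w/2} ≤ 1` for `Re w ≥ 0`. [folklore] -/
theorem norm_pi_cpow_neg_half_le_one {w : ℂ} (hw : 0 ≤ w.re) : ‖(π : ℂ) ^ (-w / 2)‖ ≤ 1 := by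
  rw [Complex.norm_cpow_eq_rpow_re_of_pos Real.pi_pos]
  apply Real.rpow_le_one_of_one_le_of_nonpos (by linarith [Real.pi_gt_three])
  simp only [neg_div, neg_re, Complex.div_ofNat_re, Left.neg_nonpos_iff]
  positivity

/-- `‖ζ(s)‖ ≤ 2` on the line `Re s = 2` (`|ζ(2+it)| ≤ Σ n^{−2} = π²/6`). [folklore] -/
theorem norm_riemannZeta_le_two_of_re_eq_two {s : ℂ} (hs : s.re = 2) : ‖riemannZeta s‖ ≤ 2 := by
  have hs1 : 1 < s.re := by rw [hs]; norm_num
  have hnorm : ∀ n : ℕ, ‖1 / (n : ℂ) ^ s‖ = 1 / (n : ℝ) ^ 2 := by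
    intro n
    rw [norm_div, norm_one, Complex.norm_natCast_cpow_of_re_ne_zero n (by rw [hs]; norm_num), hs,
      Real.rpow_two]
  rw [zeta_eq_tsum_one_div_nat_cpow hs1]
  have hsum : Summable fun n : ℕ ↦ ‖1 / (n : ℂ) ^ s‖ := by
    simp_rw [hnorm]; exact hasSum_zeta_two.summable
  calc ‖∑' n : ℕ, 1 / (n : ℂ) ^ s‖ ≤ ∑' n : ℕ, ‖1 / (n : ℂ) ^ s‖ := norm_tsum_le_tsum_norm hsum
    _ = π ^ 2 / 6 := by simp_rw [hnorm]; exact hasSum_zeta_two.tsum_eq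
    _ ≤ 2 := by nlinarith [Real.pi_lt_d2, Real.pi_pos]

/-- **`|Γ(1 + it/2)|² ≤ K e^{−π|t|/2} (1 + |t|)`** for all real `t` (Stirling order on `Re = 1`:
the tree's `‖Γ(x+iy)‖ ≤ 16π²(1+|y|)^{1/2}e^{−π|y|/2}` for `|y| ≥ 1`, and `‖Γ(1+iy)‖ ≤ Γ(1) = 1`
for `|y| < 1`). [cite: Titchmarsh1986, §4.12 eq. (4.12.2), consequence] -/
theorem exists_norm_sq_Gamma_one_add_le :
    ∃ K : ℝ, 0 < K ∧ ∀ t : ℝ,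
      ‖Complex.Gamma (1 + (t / 2 : ℝ) * I)‖ ^ 2 ≤ K * Real.exp (-(π * |t|) / 2) * (1 + |t|) := by
  refine ⟨(16 * π ^ 2) ^ 2 * Real.exp π, by positivity, fun t ↦ ?_⟩
  have hπ := Real.pi_pos
  have h0 : 0 ≤ ‖Complex.Gamma (1 + (t / 2 : ℝ) * I)‖ := norm_nonneg _
  have habs : |t / 2| = |t| / 2 := by rw [abs_div, abs_two]
  rcases le_or_gt 2 |t| with ht | ht
  · -- `|t| ≥ 2`: the Stirling-order bound of the tree
    have hy : 1 ≤ |t / 2| := by rw [habs]; linarith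
    have h := Literature.Analysis.SpecialFunctions.norm_Gamma_le_exp (x := 1) (y := t / 2) one_pos
      le_rfl hy
    rw [ofReal_one] at h
    have hsq : ((1 + |t / 2|) ^ (1 / 2 : ℝ)) ^ 2 = 1 + |t / 2| := by
      rw [← Real.rpow_natCast, ← Real.rpow_mul (by positivity)]
      norm_num
    have hexp : Real.exp (-(π * |t / 2|) / 2) ^ 2 = Real.exp (-(π * |t|) / 2) := by
      rw [← Real.exp_nat_mul, habs]
      congr 1
      push_cast
      ring
    calc ‖Complex.Gamma (1 + (t / 2 : ℝ) * I)‖ ^ 2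
        ≤ (16 * π ^ 2 * (1 + |t / 2|) ^ (1 / 2 : ℝ) * Real.exp (-(π * |t / 2|) / 2)) ^ 2 :=
          pow_le_pow_left₀ h0 h 2
      _ = (16 * π ^ 2) ^ 2 * 1 * Real.exp (-(π * |t|) / 2) * (1 + |t / 2|) := by
          rw [mul_pow, mul_pow, hsq, hexp]; ring
      _ ≤ (16 * π ^ 2) ^ 2 * Real.exp π * Real.exp (-(π * |t|) / 2) * (1 + |t|) := by
          have hle : 1 + |t / 2| ≤ 1 + |t| := by rw [habs]; linarith [abs_nonneg t]
          gcongr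
          exact Real.one_le_exp hπ.le
  · -- `|t| < 2`: `‖Γ(1 + iy)‖ ≤ Γ(1) = 1 ≤ e^{π/2} e^{-π|t|/4}`
    have h := Literature.Analysis.SpecialFunctions.GammaVert.norm_Gamma_le_Gamma_re (x := 1) one_pos
      (t / 2)
    rw [ofReal_one, Real.Gamma_one] at h
    have h1 : ‖Complex.Gamma (1 + (t / 2 : ℝ) * I)‖ ^ 2 ≤ 1 := by
      calc ‖Complex.Gamma (1 + (t / 2 : ℝ) * I)‖ ^ 2 ≤ 1 ^ 2 := pow_le_pow_left₀ h0 h 2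
        _ = 1 := one_pow 2
    have h2 : (1 : ℝ) ≤ Real.exp π * Real.exp (-(π * |t|) / 2) := by
      rw [← Real.exp_add]
      apply Real.one_le_exp
      nlinarith [abs_nonneg t]
    have h16 : (1 : ℝ) ≤ 16 * π ^ 2 := by nlinarith [Real.pi_gt_three]
    have h3 : (1 : ℝ) ≤ (16 * π ^ 2) ^ 2 := one_le_pow₀ h16
    have h4 : (1 : ℝ) ≤ 1 + |t| := by linarith [abs_nonneg t]
    calc ‖Complex.Gamma (1 + (t / 2 : ℝ) * I)‖ ^ 2 ≤ 1 := h1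
      _ ≤ (16 * π ^ 2) ^ 2 * (Real.exp π * Real.exp (-(π * |t|) / 2)) * (1 + |t|) := by
          calc (1 : ℝ) = 1 * 1 * 1 := by ring
            _ ≤ (16 * π ^ 2) ^ 2 * (Real.exp π * Real.exp (-(π * |t|) / 2)) * (1 + |t|) := by
                gcongr
      _ = (16 * π ^ 2) ^ 2 * Real.exp π * Real.exp (-(π * |t|) / 2) * (1 + |t|) := by ring

/-! ## The two edges `Re s = 2` and `Re s = −1` -/

/-- **The right edge**: there is `K > 0` with `‖ξ(z)‖² ≤ K e^{−π|t|/2}(1+|t|)⁵` on `Re z = 2`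
(`|z(z−1)/2| ≤ (1+|t|)²`, `|π^{−z/2}| ≤ 1`, `|ζ(z)| ≤ 2`, and the bound for `|Γ(1+it/2)|²`).
[cite: LagariasMontague2011, Lemma 3.3 (1) (proof)] -/
theorem exists_norm_sq_riemannXi_le_of_re_eq_two :
    ∃ K : ℝ, 0 < K ∧ ∀ z : ℂ, z.re = 2 →
      ‖riemannXi z‖ ^ 2 ≤ K * Real.exp (-(π * |z.im|) / 2) * (1 + |z.im|) ^ 5 := by
  obtain ⟨K, hK, hΓ⟩ := exists_norm_sq_Gamma_one_add_le
  refine ⟨4 * K, by positivity, fun z hz ↦ ?_⟩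
  obtain ⟨t, rfl⟩ : ∃ t : ℝ, z = 2 + t * I := ⟨z.im, by apply Complex.ext <;> simp [hz]⟩
  have ht : (2 + (t : ℂ) * I).im = t := by simp
  rw [ht]
  have hre : (2 + (t : ℂ) * I).re = 2 := by simp
  have h1 : (2 + (t : ℂ) * I) ≠ 1 := fun h ↦ by
    have := congrArg Complex.re h; rw [hre] at this; norm_num at this
  have hprod := riemannXi_eq_Gamma_mul_zeta (s := 2 + t * I) (by rw [hre]; norm_num) h1
  have hz2 : (2 + (t : ℂ) * I) / 2 = 1 + (t / 2 : ℝ) * I := by push_cast; ring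
  -- the four factors
  have hA : ‖(2 + (t : ℂ) * I) * (2 + t * I - 1) / 2‖ ≤ (1 + |t|) ^ 2 := by
    rw [norm_div, norm_mul, Complex.norm_ofNat]
    have e1 : ‖(2 : ℂ) + t * I‖ ≤ 2 + |t| := by
      refine (norm_add_le _ _).trans ?_
      simp
    have e2 : ‖(2 : ℂ) + t * I - 1‖ ≤ 1 + |t| := by
      rw [show (2 : ℂ) + t * I - 1 = 1 + t * I by ring]
      refine (norm_add_le _ _).trans ?_
      simp
    have := mul_le_mul e1 e2 (norm_nonneg _) (by positivity)
    rw [div_le_iff₀ (by norm_num : (0 : ℝ) < 2)]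
    nlinarith [abs_nonneg t]
  have hB : ‖(π : ℂ) ^ (-(2 + (t : ℂ) * I) / 2)‖ ≤ 1 :=
    norm_pi_cpow_neg_half_le_one (by rw [hre]; norm_num)
  have hC : ‖riemannZeta (2 + t * I)‖ ≤ 2 := norm_riemannZeta_le_two_of_re_eq_two hre
  have hD := hΓ t
  -- assemble: ‖ξ‖ ≤ (1+|t|)² · 1 · ‖Γ‖ · 2
  have hξ : ‖riemannXi (2 + t * I)‖ ≤
      (1 + |t|) ^ 2 * ‖Complex.Gamma (1 + (t / 2 : ℝ) * I)‖ * 2 := by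
    rw [hprod, norm_mul, norm_mul, norm_mul, hz2]
    have hG0 : 0 ≤ ‖Complex.Gamma (1 + (t / 2 : ℝ) * I)‖ := norm_nonneg _
    calc ‖(2 + (t : ℂ) * I) * (2 + t * I - 1) / 2‖ *
          (‖(π : ℂ) ^ (-(2 + (t : ℂ) * I) / 2)‖ * ‖Complex.Gamma (1 + (t / 2 : ℝ) * I)‖) *
          ‖riemannZeta (2 + t * I)‖
        ≤ (1 + |t|) ^ 2 * (1 * ‖Complex.Gamma (1 + (t / 2 : ℝ) * I)‖) * 2 := by
          gcongr
      _ = (1 + |t|) ^ 2 * ‖Complex.Gamma (1 + (t / 2 : ℝ) * I)‖ * 2 := by ring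
  have h0 : 0 ≤ ‖riemannXi (2 + t * I)‖ := norm_nonneg _
  calc ‖riemannXi (2 + t * I)‖ ^ 2
      ≤ ((1 + |t|) ^ 2 * ‖Complex.Gamma (1 + (t / 2 : ℝ) * I)‖ * 2) ^ 2 := pow_le_pow_left₀ h0 hξ 2
    _ = 4 * (1 + |t|) ^ 4 * ‖Complex.Gamma (1 + (t / 2 : ℝ) * I)‖ ^ 2 := by ring
    _ ≤ 4 * (1 + |t|) ^ 4 * (K * Real.exp (-(π * |t|) / 2) * (1 + |t|)) := by gcongr
    _ = 4 * K * Real.exp (-(π * |t|) / 2) * (1 + |t|) ^ 5 := by ring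

/-- **Both edges**: with the `K` of the right edge, `‖ξ(z)‖² ≤ K e^{−π|t|/2}(1+|t|)⁵` on `Re z = 2`
and on `Re z = −1` (functional equation `ξ(z) = ξ(1 − z)`, `Re(1 − z) = 2`, `|Im(1 − z)| = |t|`).
[cite: LagariasMontague2011, Lemma 3.3 (1) (proof)] -/
theorem exists_norm_sq_riemannXi_le_edges :
    ∃ K : ℝ, 0 < K ∧ ∀ z : ℂ, (z.re = 2 ∨ z.re = -1) →
      ‖riemannXi z‖ ^ 2 ≤ K * Real.exp (-(π * |z.im|) / 2) * (1 + |z.im|) ^ 5 := by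
  obtain ⟨K, hK, h2⟩ := exists_norm_sq_riemannXi_le_of_re_eq_two
  refine ⟨K, hK, fun z hz ↦ ?_⟩
  rcases hz with hz | hz
  · exact h2 z hz
  · have h := h2 (1 - z) (by simp [hz]; norm_num)
    rw [riemannXi_one_sub] at h
    simpa [abs_neg] using h

/-! ## Polynomial growth inside the strip -/

/-- A priori bound on `½ ≤ Re z ≤ 2`, `|Im z| ≥ 2`: `‖ξ(z)‖ ≤ 80π² (1 + |t|)⁴` (product formula,
`‖Γ(z/2)‖ ≤ 16π²(1+|t/2|)^{1/2}e^{−π|t|/4} ≤ 16π²(1+|t|)`, `‖ζ(z)‖ ≤ |z|/|z−1| + |z|/σ ≤ 5(1+|t|)`).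
[cite: Titchmarsh1986, §2.12 eq. (2.12.2), consequence] -/
theorem norm_riemannXi_le_poly_of_half_le_re {z : ℂ} (h1 : 1 / 2 ≤ z.re) (h2 : z.re ≤ 2)
    (ht : 2 ≤ |z.im|) : ‖riemannXi z‖ ≤ 80 * π ^ 2 * (1 + |z.im|) ^ 4 := by
  set t := z.im with ht_def
  have hz0 : 0 < z.re := by linarith
  have hz1 : z ≠ 1 := fun h ↦ by rw [h] at ht_def; rw [ht_def] at ht; norm_num at ht
  have him : |t| ≤ ‖z - 1‖ := by simpa [ht_def] using abs_im_le_norm (z - 1)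
  have hzn : ‖z‖ ≤ 2 * (1 + |t|) := by
    calc ‖z‖ ≤ |z.re| + |z.im| := Complex.norm_le_abs_re_add_abs_im z
      _ ≤ 2 * (1 + |t|) := by rw [abs_of_pos hz0]; linarith [abs_nonneg t]
  have hzn1 : ‖z - 1‖ ≤ 1 + |t| := by
    calc ‖z - 1‖ ≤ |(z - 1).re| + |(z - 1).im| := Complex.norm_le_abs_re_add_abs_im _
      _ ≤ 1 + |t| := by
          simp only [sub_re, one_re, sub_im, one_im, sub_zero]
          have : |z.re - 1| ≤ 1 := by rw [abs_le]; constructor <;> linarith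
          linarith
  -- the factors
  have hA : ‖z * (z - 1) / 2‖ ≤ (1 + |t|) ^ 2 := by
    rw [norm_div, norm_mul, Complex.norm_ofNat, div_le_iff₀ (by norm_num : (0 : ℝ) < 2)]
    have := mul_le_mul hzn hzn1 (norm_nonneg _) (by positivity)
    nlinarith
  have hB : ‖(π : ℂ) ^ (-z / 2)‖ ≤ 1 := norm_pi_cpow_neg_half_le_one hz0.le
  have hC : ‖Complex.Gamma (z / 2)‖ ≤ 16 * π ^ 2 * (1 + |t|) := by
    have hz2 : z / 2 = ((z.re / 2 : ℝ) : ℂ) + ((t / 2 : ℝ) : ℂ) * I := by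
      apply Complex.ext <;> simp [ht_def]
    have habs : |t / 2| = |t| / 2 := by rw [abs_div, abs_two]
    have hy : 1 ≤ |t / 2| := by rw [habs]; linarith
    have h := Literature.Analysis.SpecialFunctions.norm_Gamma_le_exp (x := z.re / 2) (y := t / 2)
      (by linarith) (by linarith) hy
    rw [hz2]
    refine h.trans ?_
    have hr : (1 + |t / 2|) ^ (1 / 2 : ℝ) ≤ 1 + |t| := by
      calc (1 + |t / 2|) ^ (1 / 2 : ℝ) ≤ (1 + |t / 2|) ^ (1 : ℝ) :=
            Real.rpow_le_rpow_of_exponent_le (by linarith [abs_nonneg (t / 2)]) (by norm_num)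
        _ ≤ 1 + |t| := by rw [Real.rpow_one, habs]; linarith [abs_nonneg t]
    have he : Real.exp (-(π * |t / 2|) / 2) ≤ 1 := by
      apply Real.exp_le_one_iff.2
      have := Real.pi_pos
      have := abs_nonneg (t / 2)
      nlinarith
    calc 16 * π ^ 2 * (1 + |t / 2|) ^ (1 / 2 : ℝ) * Real.exp (-(π * |t / 2|) / 2)
        ≤ 16 * π ^ 2 * (1 + |t|) * 1 := by gcongr
      _ = 16 * π ^ 2 * (1 + |t|) := mul_one _
  have hD : ‖riemannZeta z‖ ≤ 5 * (1 + |t|) := by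
    refine (norm_riemannZeta_le_of_re_pos hz0 hz1).trans ?_
    have e1 : ‖z‖ / ‖z - 1‖ ≤ 1 + |t| := by
      rw [div_le_iff₀ (by linarith)]
      nlinarith [abs_nonneg t]
    have e2 : ‖z‖ / z.re ≤ 4 * (1 + |t|) := by
      rw [div_le_iff₀ hz0]
      nlinarith [abs_nonneg t]
    linarith
  rw [riemannXi_eq_Gamma_mul_zeta hz0 hz1, norm_mul, norm_mul, norm_mul]
  calc ‖z * (z - 1) / 2‖ * (‖(π : ℂ) ^ (-z / 2)‖ * ‖Complex.Gamma (z / 2)‖) * ‖riemannZeta z‖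
      ≤ (1 + |t|) ^ 2 * (1 * (16 * π ^ 2 * (1 + |t|))) * (5 * (1 + |t|)) := by gcongr
    _ = 80 * π ^ 2 * (1 + |t|) ^ 4 := by ring

/-- A priori bound on the whole strip `−1 ≤ Re z ≤ 2`, `|Im z| ≥ 2`: `‖ξ(z)‖ ≤ 80π²(1+|t|)⁴`
(the previous bound, and `ξ(z) = ξ(1 − z)` for `Re z < ½`). [folklore] -/
theorem norm_riemannXi_le_poly_of_mem_strip {z : ℂ} (h1 : -1 ≤ z.re) (h2 : z.re ≤ 2)
    (ht : 2 ≤ |z.im|) : ‖riemannXi z‖ ≤ 80 * π ^ 2 * (1 + |z.im|) ^ 4 := by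
  rcases le_or_gt (1 / 2) z.re with h | h
  · exact norm_riemannXi_le_poly_of_half_le_re h h2 ht
  · have h' := norm_riemannXi_le_poly_of_half_le_re (z := 1 - z) (by simp; linarith)
      (by simp; linarith) (by simpa [abs_neg] using ht)
    rw [riemannXi_one_sub] at h'
    simpa [abs_neg] using h'

/-! ## Phragmén–Lindelöf for `g(s) = ξ(s)² e^{−iπs/2} (s + 10)^{−5}` on `−1 ≤ Re s ≤ 2` -/

/-- `‖e^{(π/2)(−i z)}‖ = e^{(π/2) Im z}`. [folklore] -/
theorem norm_exp_weight (z : ℂ) :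
    ‖Complex.exp (((π / 2 : ℝ) : ℂ) * (-I * z))‖ = Real.exp (π / 2 * z.im) := by
  rw [Complex.norm_exp]
  congr 1
  simp

/-- On `−1 ≤ Re z`: `1 + |Im z| ≤ 2 ‖z + 10‖` and `‖z + 10‖ ≤ 12 (1 + |Im z|)` (for `Re z ≤ 2`).
[folklore] -/
theorem one_add_abs_im_le {z : ℂ} (h1 : -1 ≤ z.re) (h2 : z.re ≤ 2) :
    1 + |z.im| ≤ 2 * ‖z + 10‖ ∧ ‖z + 10‖ ≤ 12 * (1 + |z.im|) := by
  have hre : (z + 10).re = z.re + 10 := by simp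
  have him : (z + 10).im = z.im := by simp
  constructor
  · have a := Complex.re_le_norm (z + 10)
    have b := Complex.abs_im_le_norm (z + 10)
    rw [hre] at a; rw [him] at b
    linarith
  · calc ‖z + 10‖ ≤ |(z + 10).re| + |(z + 10).im| := Complex.norm_le_abs_re_add_abs_im _
      _ ≤ 12 * (1 + |z.im|) := by
          rw [hre, him, abs_of_pos (by linarith)]
          linarith [abs_nonneg z.im]

/-- **The Phragmén–Lindelöf step.** For `g(z) = ξ(z)² e^{−iπz/2}/(z+10)⁵` there is `C > 0` with
`‖g(z)‖ ≤ C` on the closed strip `−1 ≤ Re z ≤ 2`: `g` is holomorphic there, bounded by `32K` on both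
edges (the edge bounds, `|e^{−iπz/2}| = e^{πt/2}`, `(1+|t|)⁵ ≤ 32|z+10|⁵`), and of growth
`O(e^{10|t|}) = O(exp(20 e^{|t|/2}))` inside, `½ < π/3` (Mathlib's `PhragmenLindelof.vertical_strip`).
[cite: LagariasMontague2011, Lemma 3.3 (1) (proof, via Phragmén–Lindelöf)] -/
theorem exists_norm_weighted_riemannXi_sq_le :
    ∃ C : ℝ, 0 < C ∧ ∀ z : ℂ, -1 ≤ z.re → z.re ≤ 2 →
      ‖riemannXi z ^ 2 * Complex.exp (((π / 2 : ℝ) : ℂ) * (-I * z)) / (z + 10) ^ 5‖ ≤ C := by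
  obtain ⟨K, hK, hedge⟩ := exists_norm_sq_riemannXi_le_edges
  refine ⟨32 * K, by positivity, fun z h1 h2 ↦ ?_⟩
  set g : ℂ → ℂ := fun z ↦
    riemannXi z ^ 2 * Complex.exp (((π / 2 : ℝ) : ℂ) * (-I * z)) / (z + 10) ^ 5 with hg
  have hnorm : ∀ w : ℂ, ‖g w‖ = ‖riemannXi w‖ ^ 2 * Real.exp (π / 2 * w.im) / ‖w + 10‖ ^ 5 := by
    intro w
    simp only [hg, norm_div, norm_mul, norm_pow, norm_exp_weight]
  have h10 : ∀ w : ℂ, -1 ≤ w.re → w + 10 ≠ 0 := by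
    intro w hw h
    have := congrArg Complex.re h
    simp at this
    linarith
  -- differentiability on the closed strip
  have hdiff : DifferentiableOn ℂ g (re ⁻¹' Icc (-1) 2) := by
    intro w hw
    apply DifferentiableAt.differentiableWithinAt
    have hw1 : -1 ≤ w.re := hw.1
    refine (((differentiable_riemannXi w).pow 2).mul ?_).div
      ((differentiableAt_id.add_const 10).pow 5) (pow_ne_zero 5 (h10 w hw1))
    exact ((differentiableAt_const _).mul ((differentiableAt_const _).mul differentiableAt_id)).cexp
  have hdcl : DiffContOnCl ℂ g (re ⁻¹' Ioo (-1) 2) := by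
    refine (hdiff.mono ?_).diffContOnCl
    refine (continuous_re.closure_preimage_subset _).trans ?_
    rw [closure_Ioo (by norm_num : (-1 : ℝ) ≠ 2)]
  -- the edges
  have hedge' : ∀ w : ℂ, (w.re = 2 ∨ w.re = -1) → ‖g w‖ ≤ 32 * K := by
    intro w hw
    have hw1 : -1 ≤ w.re := by rcases hw with h | h <;> linarith
    have hw2 : w.re ≤ 2 := by rcases hw with h | h <;> linarith
    obtain ⟨hle, -⟩ := one_add_abs_im_le hw1 hw2
    have hpos : 0 < ‖w + 10‖ := norm_pos_iff.2 (h10 w hw1)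
    have hE : Real.exp (-(π * |w.im|) / 2) * Real.exp (π / 2 * w.im) ≤ 1 := by
      rw [← Real.exp_add]
      apply Real.exp_le_one_iff.2
      have := le_abs_self w.im
      nlinarith [Real.pi_pos]
    have hP : (1 + |w.im|) ^ 5 ≤ 32 * ‖w + 10‖ ^ 5 := by
      calc (1 + |w.im|) ^ 5 ≤ (2 * ‖w + 10‖) ^ 5 := by gcongr
        _ = 32 * ‖w + 10‖ ^ 5 := by ring
    rw [hnorm, div_le_iff₀ (by positivity)]
    calc ‖riemannXi w‖ ^ 2 * Real.exp (π / 2 * w.im)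
        ≤ K * Real.exp (-(π * |w.im|) / 2) * (1 + |w.im|) ^ 5 * Real.exp (π / 2 * w.im) := by
          gcongr; exact hedge w hw
      _ = K * (1 + |w.im|) ^ 5 * (Real.exp (-(π * |w.im|) / 2) * Real.exp (π / 2 * w.im)) := by
          ring
      _ ≤ K * (32 * ‖w + 10‖ ^ 5) * 1 := by gcongr
      _ = 32 * K * ‖w + 10‖ ^ 5 := by ring
  -- growth inside the strip
  have hB : ∃ c < π / (2 - (-1)), ∃ B,
      g =O[comap (_root_.abs ∘ im) atTop ⊓ 𝓟 (re ⁻¹' Ioo (-1) 2)]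
        fun z ↦ Real.exp (B * Real.exp (c * |z.im|)) := by
    refine ⟨1 / 2, ?_, 20, ?_⟩
    · have := Real.pi_gt_three
      rw [lt_div_iff₀ (by norm_num)]; linarith
    refine IsBigO.of_bound ((80 * π ^ 2) ^ 2) ?_
    rw [eventually_inf_principal]
    have hev : ∀ᶠ w : ℂ in comap (_root_.abs ∘ im) atTop, 2 ≤ |w.im| := by
      refine eventually_comap.2 ?_
      filter_upwards [eventually_ge_atTop (2 : ℝ)] with b hb w hw
      rw [show |w.im| = b from hw]; exact hb
    filter_upwards [hev] with w hw hwmem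
    have hw1 : -1 ≤ w.re := hwmem.1.le
    have hw2 : w.re ≤ 2 := hwmem.2.le
    rw [Real.norm_eq_abs, abs_of_pos (Real.exp_pos _), hnorm]
    have hpos : 0 < ‖w + 10‖ := norm_pos_iff.2 (h10 w hw1)
    have h9 : 1 ≤ ‖w + 10‖ ^ 5 := by
      have a := Complex.re_le_norm (w + 10)
      simp at a
      exact one_le_pow₀ (by linarith)
    have hξ := norm_riemannXi_le_poly_of_mem_strip hw1 hw2 hw
    set u := |w.im| with hu
    have hu0 : 0 ≤ u := abs_nonneg _
    -- `(1+u)^8 ≤ e^{8u}`, `e^{(π/2) t} ≤ e^{2u}`, `10 u ≤ 20 e^{u/2}`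
    have hp : (1 + u) ^ 8 ≤ Real.exp (8 * u) := by
      calc (1 + u) ^ 8 ≤ (Real.exp u) ^ 8 := by
            gcongr; have := Real.add_one_le_exp u; linarith
        _ = Real.exp (8 * u) := by rw [← Real.exp_nat_mul]; norm_num
    have he : Real.exp (π / 2 * w.im) ≤ Real.exp (2 * u) := by
      apply Real.exp_le_exp.2
      have := le_abs_self w.im
      nlinarith [Real.pi_lt_four, Real.pi_pos]
    have hlin : 10 * u ≤ 20 * Real.exp (1 / 2 * u) := by
      have := Real.add_one_le_exp (1 / 2 * u); nlinarith
    calc ‖riemannXi w‖ ^ 2 * Real.exp (π / 2 * w.im) / ‖w + 10‖ ^ 5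
        ≤ ‖riemannXi w‖ ^ 2 * Real.exp (π / 2 * w.im) := div_le_self (by positivity) h9
      _ ≤ (80 * π ^ 2 * (1 + u) ^ 4) ^ 2 * Real.exp (2 * u) := by gcongr
      _ = (80 * π ^ 2) ^ 2 * ((1 + u) ^ 8 * Real.exp (2 * u)) := by ring
      _ ≤ (80 * π ^ 2) ^ 2 * (Real.exp (8 * u) * Real.exp (2 * u)) := by gcongr
      _ = (80 * π ^ 2) ^ 2 * Real.exp (10 * u) := by rw [← Real.exp_add]; ring_nf
      _ ≤ (80 * π ^ 2) ^ 2 * Real.exp (20 * Real.exp (1 / 2 * u)) := by gcongr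
  have hle_a : ∀ w : ℂ, w.re = -1 → ‖g w‖ ≤ 32 * K := fun w hw ↦ hedge' w (Or.inr hw)
  have hle_b : ∀ w : ℂ, w.re = 2 → ‖g w‖ ≤ 32 * K := fun w hw ↦ hedge' w (Or.inl hw)
  have key := PhragmenLindelof.vertical_strip hdcl hB hle_a hle_b h1 h2
  simpa only [hg] using key

/-! ## The discharge -/

/-- The bound for `Im s ≥ 0`: there is `C₁ > 0` with `‖ξ(s)‖ ≤ C₁ e^{−π|t|/4}(|t|+1)^{5/2}` for
`½ ≤ Re s ≤ 2`, `t = Im s ≥ 0` (from the Phragmén–Lindelöf bound: `‖ξ(s)‖² e^{πt/2} ≤ C‖s+10‖⁵ ≤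
C·12⁵(1+t)⁵`). [cite: LagariasMontague2011, Lemma 3.3 (1)] -/
theorem exists_norm_riemannXi_le_of_im_nonneg :
    ∃ C₁ : ℝ, 0 < C₁ ∧ ∀ s : ℂ, 1 / 2 ≤ s.re → s.re ≤ 2 → 0 ≤ s.im →
      ‖riemannXi s‖ ≤ C₁ * Real.exp (-(π / 4) * |s.im|) * (|s.im| + 1) ^ (5 / 2 : ℝ) := by
  obtain ⟨C, hC, hPL⟩ := exists_norm_weighted_riemannXi_sq_le
  refine ⟨Real.sqrt (C * 12 ^ 5), Real.sqrt_pos.2 (by positivity), fun s h1 h2 ht ↦ ?_⟩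
  have h1' : -1 ≤ s.re := by linarith
  have h := hPL s h1' h2
  obtain ⟨-, h12⟩ := one_add_abs_im_le h1' h2
  have habs : |s.im| = s.im := abs_of_nonneg ht
  rw [norm_div, norm_mul, norm_pow, norm_exp_weight, norm_pow] at h
  have h10 : s + 10 ≠ 0 := fun h ↦ by
    have := congrArg Complex.re h; simp at this; linarith
  have hpos : 0 < ‖s + 10‖ := norm_pos_iff.2 h10
  rw [div_le_iff₀ (by positivity)] at h
  -- `‖ξ‖² ≤ C ‖s+10‖⁵ e^{-πt/2} ≤ C 12⁵ (1+t)⁵ e^{-πt/2}`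
  have hE : Real.exp (π / 2 * s.im) * Real.exp (-(π / 2) * |s.im|) = 1 := by
    rw [← Real.exp_add, habs]; convert Real.exp_zero using 2; ring
  have hsq : ‖riemannXi s‖ ^ 2 ≤ C * 12 ^ 5 * (1 + |s.im|) ^ 5 * Real.exp (-(π / 2) * |s.im|) := by
    have hmul := mul_le_mul_of_nonneg_right h (Real.exp_pos (-(π / 2) * |s.im|)).le
    calc ‖riemannXi s‖ ^ 2
        = ‖riemannXi s‖ ^ 2 * (Real.exp (π / 2 * s.im) * Real.exp (-(π / 2) * |s.im|)) := by
          rw [hE, mul_one]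
      _ = ‖riemannXi s‖ ^ 2 * Real.exp (π / 2 * s.im) * Real.exp (-(π / 2) * |s.im|) := by ring
      _ ≤ C * ‖s + 10‖ ^ 5 * Real.exp (-(π / 2) * |s.im|) := hmul
      _ ≤ C * (12 * (1 + |s.im|)) ^ 5 * Real.exp (-(π / 2) * |s.im|) := by gcongr
      _ = C * 12 ^ 5 * (1 + |s.im|) ^ 5 * Real.exp (-(π / 2) * |s.im|) := by ring
  -- take square roots
  have hb0 : 0 ≤ Real.sqrt (C * 12 ^ 5) * Real.exp (-(π / 4) * |s.im|) * (|s.im| + 1) ^ (5 / 2 : ℝ) := by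
    positivity
  refine le_of_pow_le_pow_left₀ two_ne_zero hb0 (hsq.trans_eq ?_)
  have hu : 0 ≤ |s.im| + 1 := by positivity
  have hr : ((|s.im| + 1) ^ (5 / 2 : ℝ)) ^ 2 = (1 + |s.im|) ^ 5 := by
    rw [← Real.rpow_natCast, ← Real.rpow_mul hu, add_comm]
    norm_num
  have he : Real.exp (-(π / 4) * |s.im|) ^ 2 = Real.exp (-(π / 2) * |s.im|) := by
    rw [← Real.exp_nat_mul]; congr 1; push_cast; ring
  rw [mul_pow, mul_pow, Real.sq_sqrt (by positivity), hr, he]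
  ring

/-- DISCHARGE of the named fact `LagariasMontague2011_lemma33_1` (**Lagarias–Montague 2011,
Lemma 3.3 (1)**): there is `C₁ > 0` such that `|ξ(s)| ≤ C₁ e^{−π|t|/4} (|t| + 1)^{5/2}` for
`½ ≤ Re s ≤ 2`. For `Im s ≥ 0` this is the previous theorem; for `Im s < 0` apply it to `s̄`
(`ξ(s̄) = conj ξ(s)`, `Literature.NumberTheory.LFunctions.riemannXi_conj_holds`).
[cite: LagariasMontague2011, Lemma 3.3 (1)] -/
theorem LagariasMontague2011_lemma33_1_holds : LagariasMontague2011_lemma33_1 := by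
  obtain ⟨C₁, hC₁, h⟩ := exists_norm_riemannXi_le_of_im_nonneg
  refine ⟨C₁, hC₁, fun s h1 h2 ↦ ?_⟩
  rcases le_or_gt 0 s.im with ht | ht
  · exact h s h1 h2 ht
  · have h' := h (conj s) (by simpa using h1) (by simpa using h2) (by simp; linarith)
    rw [show riemannXi (conj s) = conj (riemannXi s) from riemannXi_conj_holds s,
      Complex.norm_conj] at h'
    simpa [abs_neg] using h'

end Literature.NumberTheory.LFunctions
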